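import Literature.MathematicalPhysics.QuantumFieldTheory.Balaban1983to89.B4Eq19LatticeOperators
import Summits.QuantumFields.YangMills.Theorems.UnitScaleTiltCurvGradAxialFlat
import HarnessLib

/-!
# Line «sandwich_discharge» on crux `HistoryTailL` (stmt-QuantumFields-19936), stub `stub_sandwichSweepGapCapped` (S′), brick B5 on `ℤ³` —
# (r3) «THE NON-ABELIAN CLOSURE DEFECT, SUPPLIED»: for the READ plaquette field `F(y,μ,ν) = λ(V(∂p_{μν}(y)) − 1)` of a `U1`-valued lattice
# configuration, the alternating cube derivative obeys `|(d₂F)(y,κ,μ,ν)| ≤ ‖λ‖·(60a² + 6βa)` at EVERY index triple — the `η` of the knit's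
# hypothesis `hdFle : ∀ y ∈ box p S, ∀ κ μ ν, |dF y κ μ ν| ≤ η` (px8 g7 (Z-e) FILE 1 `abs_bulk_le` ∕ `abs_sum_curl_truncated_mul_sub_le`)

Cell `ym3-torus` (YM ladder rung R3 = continuum SU(2) Yang–Mills on the three-torus — a RUNG, NOT the Clay problem: not d = 4, not infinite volume,
not a mass gap); WIDTH helper seat `ym3-torus-px6` gen 8; `--supports stmt-QuantumFields-19936` (helper).  THEOREMS ONLY (0 `def`, default heartbeats).

WHY (px8 g6 ARCH-S′ §6 (r3); w8 g8 LOCATE-B5-Z3 §7 (c), ADDENDUM-B5-CONSTANTS §C «`|d₂F| ≤ C_B·θ_K²`»).  The commutator truncation of brick B5 pairs the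
truncated potential against a real 2-form `F`; its bulk term is `⅓⟨χ̂γ, d₂F⟩` ((Z-a) ✓`sum_mul_dTwo_eq_three_mul`), priced by the knit under the
HYPOTHESIS `|d₂F| ≤ η` on a box.  In the stub `F` READS the plaquette field of a GAUGE configuration and is closed only up to the lattice Bianchi
commutator.  The tree already has the group-level fact: ✓`CurvGradAxial.norm_d2_plaqF_le` (`UnitScaleTiltCurvGradAxialBianchi`) — for `V : Site d → Fin d → 𝔸ˣ`
`U1`-valued with `‖F^{plaq}(κ,μ;y) − 1‖ ≤ a ≤ 1` on all plaquettes and `‖V(x,μ) − 1‖ ≤ β` on the three tails at `x`, at DISTINCT `i,j,k`: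
`‖∇ᵢF^{plaq}_{jk} − ∇ⱼF^{plaq}_{ik} + ∇ₖF^{plaq}_{ij}‖(x) ≤ 60a² + 6βa`, whose index pattern IS (Z-a)'s ALTERNATING `d₂` (`Site d = Zd d`, `e = unitVec`
definitionally), and its ALL-TRIPLES corollary ✓`CurvGradAxial.norm_d2_le` (`UnitScaleTiltCurvGradAxialFlat`, stated for lit `LatticeForm.d₂` of
✓`CubicalCochains` applied to `F^{plaq} − 1`; repeated indices cost `0` or a reversed pair `≤ 2a²`).  THIS FILE makes `C_B` a NAME for the knit: §1 `d₂`
commutes with a continuous linear READING `λ` (`dTwo_read_eq`, `abs_dTwo_read_le`; any real normed space); §2 ★★`abs_dTwo_read_plaqF_le` — ALL triples: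
`|(d₂F)(y,κ,μ,ν)| ≤ ‖λ‖·(60a² + 6βa)` (✓`norm_d2_le` read through `λ`; the all-pairs plaquette hypothesis it wants follows from the `κ ≠ μ` one by
✓`CurvGradAxial.plaqF_self`); §3 ★★`dTwo_read_plaqF_le_on_box` — the knit's `hdFle` VERBATIM (`∀ y ∈ box p S, ∀ κ μ ν, |dF y κ μ ν| ≤ η`,
`η := ‖λ‖·(60a² + 6βa)`, `dF` in (Z-a)'s free-symbol letter `hdF`) from tail bounds on `box p S`, and `…_everywhere`.  WHAT STAYS THE KNIT'S: `hP` is GLOBAL on `ℤ^d` as in the source theorem (discharge on the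
PERIODIC PULL-BACK of the torus field under FINER(b)), and the SIZE of `β` (tree∕axial gauge on the ball, `β ≲ R·a`).  HONEST SCOPE: bookkeeping over
one landed identity; NOTHING here proves B5, the capped stub, `HistoryTailL`, or any summit statement; YM₃ on T³ is rung R3, not Clay. [folklore]
-/

noncomputable section

open scoped BigOperators
open Finset

namespace Summit.QuantumFields.YangMills.Theorems.CovariantDischargeClosureDefectBianchi

open Literature.MathematicalPhysics.QuantumFieldTheory.Balaban1983to89.B4Eq19LatticeOperators (Zd unitVec box)
open Literature.MathematicalPhysics.QuantumFieldTheory.Balaban1983to89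
open B7Prop1Explicit (Site e hol plaqWord U1 hol_mem)
open B8Ineq132 (plaqF)

variable {d : ℕ}

/-! ## §1 `d₂` commutes with a linear READING of an `𝔸`-valued 2-form -/

section Read

variable {𝔸 : Type*} [NormedAddCommGroup 𝔸] [NormedSpace ℝ 𝔸]

/-- **`d₂` COMMUTES WITH A LINEAR READING**: if `F(x,μ,ν) = λ(G(x,μ,ν) − c)` for a real continuous linear functional `λ` and a constant `c`, then
the alternating cube derivative of `F` is `λ` of that of `G` (the constant drops out). [folklore] -/
theorem dTwo_read_eq (lam : 𝔸 →L[ℝ] ℝ) (G : Zd d → Fin d → Fin d → 𝔸) (c : 𝔸) (F : Zd d → Fin d → Fin d → ℝ)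
    (hF : ∀ x μ ν, F x μ ν = lam (G x μ ν - c)) (x : Zd d) (κ μ ν : Fin d) :
    (F (x + unitVec κ) μ ν - F x μ ν) - (F (x + unitVec μ) κ ν - F x κ ν) + (F (x + unitVec ν) κ μ - F x κ μ)
      = lam ((G (x + unitVec κ) μ ν - G x μ ν) - (G (x + unitVec μ) κ ν - G x κ ν) + (G (x + unitVec ν) κ μ - G x κ μ)) := by
  simp only [hF, map_sub, map_add]
  ring

/-- Hence `|d₂F(x,κ,μ,ν)| ≤ ‖λ‖ · ‖d₂G(x,κ,μ,ν)‖`. [folklore] -/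
theorem abs_dTwo_read_le (lam : 𝔸 →L[ℝ] ℝ) (G : Zd d → Fin d → Fin d → 𝔸) (c : 𝔸) (F : Zd d → Fin d → Fin d → ℝ)
    (hF : ∀ x μ ν, F x μ ν = lam (G x μ ν - c)) (x : Zd d) (κ μ ν : Fin d) :
    |(F (x + unitVec κ) μ ν - F x μ ν) - (F (x + unitVec μ) κ ν - F x κ ν) + (F (x + unitVec ν) κ μ - F x κ μ)|
      ≤ ‖lam‖ * ‖(G (x + unitVec κ) μ ν - G x μ ν) - (G (x + unitVec μ) κ ν - G x κ ν) + (G (x + unitVec ν) κ μ - G x κ μ)‖ := by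
  rw [dTwo_read_eq lam G c F hF x κ μ ν, ← Real.norm_eq_abs]
  exact lam.le_opNorm _

end Read

/-! ## §2 All index triples: `|d₂F| ≤ ‖λ‖·(60a² + 6βa)` for a read plaquette field -/

section Gauge

variable {𝔸 : Type*} [NormedRing 𝔸] [NormOneClass 𝔸] [NormedAlgebra ℝ 𝔸]

omit [NormOneClass 𝔸] [NormedAlgebra ℝ 𝔸] in
/-- The tree's `B7Prop1Explicit.e μ` IS `B4Eq19LatticeOperators.unitVec μ` (both `Pi.single μ 1` on `Fin d → ℤ`). [folklore] -/
theorem e_eq_unitVec (μ : Fin d) : (e μ : Site d) = unitVec μ := rfl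

omit [NormOneClass 𝔸] [NormedAlgebra ℝ 𝔸] in
/-- The all-pairs plaquette bound from the off-diagonal one: the degenerate plaquette field is `1` (✓`CurvGradAxial.plaqF_self`). [folklore] -/
theorem norm_plaqF_sub_one_le_all (V : Site d → Fin d → 𝔸ˣ) {a : ℝ} (ha : 0 ≤ a)
    (hP : ∀ (y : Site d) (κ μ : Fin d), κ ≠ μ → ‖plaqF V κ μ y - 1‖ ≤ a) (y : Site d) (κ μ : Fin d) : ‖plaqF V κ μ y - 1‖ ≤ a := by
  by_cases h : κ = μ
  · subst h; rw [CurvGradAxial.plaqF_self, sub_self, norm_zero]; exact ha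
  · exact hP y κ μ h

/-- ★★ **THE CUBE DERIVATIVE OF A READ PLAQUETTE FIELD IS `O(a² + βa)` AT EVERY INDEX TRIPLE**: for a `U1 𝔸`-valued `V` on `ℤ^d` with
`‖F^{plaq}(κ,μ;y) − 1‖ ≤ a ≤ 1` on every plaquette (`κ ≠ μ`) and `‖V(x,μ) − 1‖ ≤ β` on the bonds issuing from `x`, and `F(y,μ,ν) = λ(F^{plaq}V(μ,ν;y) − 1)`:
`|(d₂F)(x,κ,μ,ν)| ≤ ‖λ‖·(60a² + 6βa)` for ALL `κ, μ, ν` (tree ✓`CurvGradAxial.norm_d2_le` read through `λ`). [folklore] -/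
theorem abs_dTwo_read_plaqF_le (V : Zd d → Fin d → 𝔸ˣ) (hV : ∀ x κ, V x κ ∈ U1 𝔸) {a β : ℝ} (ha : 0 ≤ a) (ha1 : a ≤ 1) (hβ : 0 ≤ β)
    (hP : ∀ (y : Zd d) (κ μ : Fin d), κ ≠ μ → ‖plaqF V κ μ y - 1‖ ≤ a) (lam : 𝔸 →L[ℝ] ℝ) (F : Zd d → Fin d → Fin d → ℝ)
    (hF : ∀ x μ ν, F x μ ν = lam (plaqF V μ ν x - 1)) (x : Zd d) (hx : ∀ μ, ‖(V x μ : 𝔸) - 1‖ ≤ β) (κ μ ν : Fin d) :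
    |(F (x + unitVec κ) μ ν - F x μ ν) - (F (x + unitVec μ) κ ν - F x κ ν) + (F (x + unitVec ν) κ μ - F x κ μ)|
      ≤ ‖lam‖ * (60 * a ^ 2 + 6 * β * a) := by
  have hF' : ∀ y μ ν, F y μ ν = lam ((fun z κ' μ' => plaqF V κ' μ' z - 1) y μ ν - 0) := fun y μ ν => by rw [sub_zero]; exact hF y μ ν
  refine (abs_dTwo_read_le lam (fun z κ' μ' => plaqF V κ' μ' z - 1) 0 F hF' x κ μ ν).trans (mul_le_mul_of_nonneg_left ?_ (norm_nonneg _))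
  exact CurvGradAxial.norm_d2_le hV ha ha1 hβ (norm_plaqF_sub_one_le_all V ha hP) x hx κ μ ν

/-! ## §3 The knit's hypothesis `hdFle`, supplied on a box -/

/-- ★★ **THE KNIT'S `hdFle`, SUPPLIED.**  With `dF` the alternating cube derivative of `F = λ(F^{plaq}V − 1)` ((Z-a)'s letter `hdF`), a `U1 𝔸`-valued `V`
with `‖F^{plaq} − 1‖ ≤ a ≤ 1` on every plaquette of `ℤ^d` and `‖V(y,μ) − 1‖ ≤ β` on the bonds issuing from the sites of `Q_S(p)`:
`∀ y ∈ Q_S(p), ∀ κ μ ν, |dF(y,κ,μ,ν)| ≤ ‖λ‖·(60a² + 6βa)` — token for token the hypothesis `hdFle` of the (Z-e) pairing rows, with `η := ‖λ‖·(60a² + 6βa)`.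
[folklore] -/
theorem dTwo_read_plaqF_le_on_box (V : Zd d → Fin d → 𝔸ˣ) (hV : ∀ x κ, V x κ ∈ U1 𝔸) {a β : ℝ} (ha : 0 ≤ a) (ha1 : a ≤ 1) (hβ : 0 ≤ β)
    (hP : ∀ (y : Zd d) (κ μ : Fin d), κ ≠ μ → ‖plaqF V κ μ y - 1‖ ≤ a) (lam : 𝔸 →L[ℝ] ℝ) (F : Zd d → Fin d → Fin d → ℝ)
    (hF : ∀ x μ ν, F x μ ν = lam (plaqF V μ ν x - 1)) (dF : Zd d → Fin d → Fin d → Fin d → ℝ)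
    (hdF : ∀ x κ μ ν, dF x κ μ ν = (F (x + unitVec κ) μ ν - F x μ ν) - (F (x + unitVec μ) κ ν - F x κ ν) + (F (x + unitVec ν) κ μ - F x κ μ))
    (p : Zd d) (S : ℤ) (hxS : ∀ y ∈ box p S, ∀ μ, ‖(V y μ : 𝔸) - 1‖ ≤ β) :
    ∀ y ∈ box p S, ∀ κ μ ν, |dF y κ μ ν| ≤ ‖lam‖ * (60 * a ^ 2 + 6 * β * a) := by
  intro y hy κ μ ν
  rw [hdF]
  exact abs_dTwo_read_plaqF_le V hV ha ha1 hβ hP lam F hF y (hxS y hy) κ μ ν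

/-- The same supplier with the tail bound asked at EVERY site (e.g. a configuration in a global small gauge). [folklore] -/
theorem dTwo_read_plaqF_le_everywhere (V : Zd d → Fin d → 𝔸ˣ) (hV : ∀ x κ, V x κ ∈ U1 𝔸) {a β : ℝ} (ha : 0 ≤ a) (ha1 : a ≤ 1) (hβ : 0 ≤ β)
    (hP : ∀ (y : Zd d) (κ μ : Fin d), κ ≠ μ → ‖plaqF V κ μ y - 1‖ ≤ a) (lam : 𝔸 →L[ℝ] ℝ) (F : Zd d → Fin d → Fin d → ℝ)
    (hF : ∀ x μ ν, F x μ ν = lam (plaqF V μ ν x - 1)) (dF : Zd d → Fin d → Fin d → Fin d → ℝ)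
    (hdF : ∀ x κ μ ν, dF x κ μ ν = (F (x + unitVec κ) μ ν - F x μ ν) - (F (x + unitVec μ) κ ν - F x κ ν) + (F (x + unitVec ν) κ μ - F x κ μ))
    (hx : ∀ y μ, ‖(V y μ : 𝔸) - 1‖ ≤ β) (y : Zd d) (κ μ ν : Fin d) :
    |dF y κ μ ν| ≤ ‖lam‖ * (60 * a ^ 2 + 6 * β * a) := by
  rw [hdF]
  exact abs_dTwo_read_plaqF_le V hV ha ha1 hβ hP lam F hF y (hx y) κ μ ν

/-- **NON-VACUITY ∕ THE FLAT CASE**: for the trivial configuration `V = 1` every hypothesis holds with `a = β = 0` and the bound reads `|d₂F| ≤ 0`, i.e.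
`F = λ(F^{plaq}1 − 1) = 0` is `d₂`-closed, as it must be. [folklore] -/
theorem dTwo_read_plaqF_one (lam : 𝔸 →L[ℝ] ℝ) (F : Zd d → Fin d → Fin d → ℝ)
    (hF : ∀ x μ ν, F x μ ν = lam (plaqF (fun (_ : Zd d) (_ : Fin d) => (1 : 𝔸ˣ)) μ ν x - 1)) (x : Zd d) (κ μ ν : Fin d) :
    (F (x + unitVec κ) μ ν - F x μ ν) - (F (x + unitVec μ) κ ν - F x κ ν) + (F (x + unitVec ν) κ μ - F x κ μ) = 0 := by
  have hV : ∀ (x : Zd d) (κ : Fin d), (fun (_ : Zd d) (_ : Fin d) => (1 : 𝔸ˣ)) x κ ∈ U1 𝔸 := fun _ _ => one_mem _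
  have hP : ∀ (y : Zd d) (κ μ : Fin d), κ ≠ μ → ‖plaqF (fun (_ : Zd d) (_ : Fin d) => (1 : 𝔸ˣ)) κ μ y - 1‖ ≤ 0 := by
    intro y κ μ _
    rw [show plaqF (fun (_ : Zd d) (_ : Fin d) => (1 : 𝔸ˣ)) κ μ y = 1 from by
      rw [show plaqF (fun (_ : Zd d) (_ : Fin d) => (1 : 𝔸ˣ)) κ μ y = ((hol (fun (_ : Site d) (_ : Fin d) => (1 : 𝔸ˣ)) y (plaqWord κ μ) : 𝔸ˣ) : 𝔸)
        from rfl, CurvGradAxial.hol_plaqWord_eq]; simp]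
    simp
  have h := abs_dTwo_read_plaqF_le (fun (_ : Zd d) (_ : Fin d) => (1 : 𝔸ˣ)) hV le_rfl zero_le_one le_rfl hP lam F hF x
    (fun μ => by simp) κ μ ν
  have h0 : |(F (x + unitVec κ) μ ν - F x μ ν) - (F (x + unitVec μ) κ ν - F x κ ν) + (F (x + unitVec ν) κ μ - F x κ μ)| ≤ 0 := by
    simpa using h
  exact abs_eq_zero.1 (le_antisymm h0 (abs_nonneg _))

end Gauge

end Summit.QuantumFields.YangMills.Theorems.CovariantDischargeClosureDefectBianchi

end
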